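import Literature.MathematicalPhysics.QuantumFieldTheory.Balaban1983to89.B9Eq346GradGpDivAtPinsL2Knit

/-!
# `Balaban1983to89.B9Eq346GradGpDivAtPinsL2KnitClosed` — [B9] Thm 3.1 (3.46)₄ for `G′(U; parKnitY)` in block-`L²` at the N06 certificate's KNIT letters: dag-n06-l's
# member-uniform theorem `B9Eq346GradGpDivAtPinsL2Knit.blockBd_DvGcoSDvs_memberY_knit` WITH ITS FOUR EXISTENTIAL CONSTANTS NAMED (`M46K a46K B46K δ46K`) — the closed
# terms the knit certificate's displayed numerics refer to (the knit twin of `B9Eq346GradGpDivAtPinsL2Closed`)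

T. Bałaban, *Propagators for lattice gauge theories in a background field*, Commun. Math. Phys. **99** (1985) 389–434 [`Balaban1985BackgroundPropagators`, "B9"],
Thm 3.1 (3.46) p. 398 (the order-zero entry `∇_U G′(U) ∇*_U`), (3.19) p. 393 (the averaged transporters), (3.35) p. 396; T. Bałaban, *Averaging operations for lattice
gauge theories*, Commun. Math. Phys. **98** (1985) 17–51 [`Balaban1985Averaging`], Prop. 2 (52)–(53) p. 26; T. Bałaban, *Propagators and renormalization transformations
for lattice gauge theories. II*, Commun. Math. Phys. **96** (1984) 223–250 [`Balaban1984PropagatorsII`], (2.46) p. 231, (2.51)–(2.54) pp. 232–233.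

statement-level skeleton of published theorems with citation tags; proofs where landed; nothing here is a claim about the Yang–Mills mass gap

WHY THIS FILE (cell `pub-ymgap`, Track A node N06 [B9]; seat `pub-ymgap-dag-n06-l` (g40), bundle F7 rows 20–21; 2026-08-30).
dag-n06-l's `blockBd_DvGcoSDvs_memberY_knit` (✓p781812) proves the knit certificate's displayed letter `h46K` («KC» ✓p795195 ∕ «KE₁» ✓p795758) in the shape
`∃ M₄ a₄ B₄ δ₄ > 0, ∀ hG1 hGU x, M₄ ≤ M_x → ∀ c₀ ≤ 10, ∀ α₀ > 0, ∀ α₀′ (knit numerics, K_pl(M_xα₀)·L⁴ < α₀′), ∀ α₁ > 0, M_x·α₁ ≤ a₄ → ∀ U ∈ Reg335′ c₀ α₀ ∩ Reg335 c α₁,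
∀ bI hlev hβ1 R₀ H₀, BlockBd (blkBK bI) (blkBK bI) (D_U G′(U; parKnitY) D*_U) (B₄·e^{−δ₄ d})`.
The certificate cannot open this `∃` INSIDE its proof: its displayed numerics carry the side condition `hrT4 : rT ≤ δ46K` (with `hδTr : δT12 + 3σS + 3·(…) ≤ rT`), which ties
the rate to rates shared with OTHER displayed letters — so `δ46K` (and `B46K`, and the thresholds `M46K a46K`) must be TERMS of the statement when «KE₂» folds `h46K`.  This file
names them by `Classical.choose` — `M46K a46K B46K δ46K` (functions of `d ℓ hd hL b₀ b₁ M⋆ N c` and the proof `hc : 0 < c`) — and restates dag-n06-l's theorem AT THEM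
(`blockBd_DvGcoSDvs_memberY_knit_at`), with the four positivity facts.  Nothing is re-proved; nothing of [B9] is asserted beyond ✓p781812.

HONEST SCOPE.  Four named constants and one specialisation; COUNT-NEUTRAL; N06 NOT discharged; one finite lattice programme — nothing continuum, nothing about OS
positivity or the mass gap.  No `sorry`, no `axiom`, no `instance`, no `notation`.  NEW file (knit twin of `B9Eq346GradGpDivAtPinsL2Closed`; parents untouched).
RELATED, NOT DUPLICATED (searched 2026-08-30: `rg -l -w "B9Eq346GradGpDivAtPinsL2KnitClosed|blockBd_DvGcoSDvs_memberY_knit_at|M46K_pos|δ46K_pos"` over `lean/{Literature,Summits,HarnessLib}` = ∅;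
the tokens `M46K a46K B46K δ46K` occur in the tree only as BINDER names of the certificates «KD′»∕«KC»∕«KE₁», never as declarations).
-/

noncomputable section

namespace Literature.MathematicalPhysics.QuantumFieldTheory.Balaban1983to89.B9Eq346GradGpDivAtPinsL2KnitClosed

open Literature.MathematicalPhysics.QuantumFieldTheory.Balaban1983to89
open Node00 B6KLevelCensusIndexV1 B6Geom246MultiLevelBox B6MultiLevelTorusOperator B6GlobalChartV1 B9BackgroundsKLevelV1 B6Geom246MultiLevelTorus
open Literature.MathematicalPhysics.QuantumFieldTheory.Balaban1983to89.B6Ineq2142KLevelV1 (lvl β)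
open Literature.MathematicalPhysics.QuantumFieldTheory.Balaban1983to89.B9CoReadingCoords (XBK blkBK)
open Literature.MathematicalPhysics.QuantumFieldTheory.Balaban1983to89.B9CoReadingCoordsS (XSK GcoS)
open Literature.MathematicalPhysics.QuantumFieldTheory.Balaban1983to89.B9CoReadingCoordsTranspose (TrIdx trBasis)
open Literature.MathematicalPhysics.QuantumFieldTheory.Balaban1983to89.B9Thm34Ext (toB6)
open Literature.MathematicalPhysics.QuantumFieldTheory.Balaban1983to89.B9SectDL2Decay (BlockBd)
open Literature.MathematicalPhysics.QuantumFieldTheory.Balaban1983to89.B9PinMembersKLevelV1 (MemberY geo9Y bg9Y)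
open Literature.MathematicalPhysics.QuantumFieldTheory.Balaban1983to89.Node00.OpsYSectDCoords (DvcoKH DvscoKH)
open Literature.MathematicalPhysics.QuantumFieldTheory.Balaban1983to89.B7Prop2Explicit (C0 c2' unitaryUnits)
open Literature.MathematicalPhysics.QuantumFieldTheory.Balaban1983to89.B9B8AveragingJunction (parKnitY)
open Literature.MathematicalPhysics.QuantumFieldTheory.Balaban1983to89.B9C2FormBoxRegimeY (Kpl)
open Literature.MathematicalPhysics.QuantumFieldTheory.Balaban1983to89.B9BackgroundsKLevelV1P (bg9KP)
open Literature.MathematicalPhysics.QuantumFieldTheory.Balaban1983to89.B9Eq346GradGpDivAtPinsL2Knit (blockBd_DvGcoSDvs_memberY_knit)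
open scoped Matrix Matrix.Norms.L2Operator

variable (d ℓ : ℕ) (hd : 1 ≤ d + 1) (hL : Odd (ℓ + 1) ∧ 1 < ℓ + 1) (b₀ b₁ : ℝ) (Mstar N : ℕ) [NeZero N] (c : ℝ) (hc : 0 < c)

/-- **THE THRESHOLD `M₄` OF THE KNIT (3.46)₄ IN BLOCK-`L²`, NAMED**: the first existential constant of dag-n06-l's `blockBd_DvGcoSDvs_memberY_knit` (a function of the
member family's data `d ℓ b₀ b₁ M⋆ N` and the class constant `c`).  [cite: Balaban1985BackgroundPropagators, Thm 3.1 (3.46) p.398, (3.19) p.393] -/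
def M46K : ℝ := (blockBd_DvGcoSDvs_memberY_knit d ℓ hd hL b₀ b₁ Mstar N hc).choose

/-- **THE SMALLNESS THRESHOLD `a₄` (`M·α₁ ≤ a₄`) OF THE KNIT (3.46)₄ IN BLOCK-`L²`, NAMED** (second existential constant of `blockBd_DvGcoSDvs_memberY_knit`).
[cite: Balaban1985BackgroundPropagators, Thm 3.1 (3.46) p.398, (3.35) p.396] -/
def a46K : ℝ := (blockBd_DvGcoSDvs_memberY_knit d ℓ hd hL b₀ b₁ Mstar N hc).choose_spec.choose

/-- **THE CONSTANT `B₄` OF THE KNIT (3.46)₄ IN BLOCK-`L²`, NAMED** (third existential constant of `blockBd_DvGcoSDvs_memberY_knit`).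
[cite: Balaban1985BackgroundPropagators, Thm 3.1 (3.46) p.398] -/
def B46K : ℝ := (blockBd_DvGcoSDvs_memberY_knit d ℓ hd hL b₀ b₁ Mstar N hc).choose_spec.choose_spec.choose

/-- **THE DECAY RATE `δ₄` OF THE KNIT (3.46)₄ IN BLOCK-`L²`, NAMED** (fourth existential constant of `blockBd_DvGcoSDvs_memberY_knit`) — the closed term the knit
certificate's side condition `rT ≤ δ46K` refers to.  [cite: Balaban1985BackgroundPropagators, Thm 3.1 (3.46) p.398] -/
def δ46K : ℝ := (blockBd_DvGcoSDvs_memberY_knit d ℓ hd hL b₀ b₁ Mstar N hc).choose_spec.choose_spec.choose_spec.choose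

/-- The defining property of the four named constants (dag-n06-l's theorem, unpacked once). [cite: Balaban1985BackgroundPropagators, Thm 3.1 (3.46) p.398, bookkeeping] -/
private theorem spec46K : 0 < M46K d ℓ hd hL b₀ b₁ Mstar N c hc ∧ 0 < a46K d ℓ hd hL b₀ b₁ Mstar N c hc ∧ 0 < B46K d ℓ hd hL b₀ b₁ Mstar N c hc ∧ 0 < δ46K d ℓ hd hL b₀ b₁ Mstar N c hc ∧
    ∀ {G : Subgroup (Matrix (Fin N) (Fin N) ℂ)ˣ} (_ : ∀ u : (Matrix (Fin N) (Fin N) ℂ)ˣ, u ∈ G → ‖(u : Matrix (Fin N) (Fin N) ℂ)‖ ≤ 1)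
      (_ : G ≤ unitaryUnits (Matrix (Fin N) (Fin N) ℂ)) (x : MemberY d ℓ hd hL b₀ b₁ Mstar), M46K d ℓ hd hL b₀ b₁ Mstar N c hc ≤ (geo9Y x).M →
      ∀ {c₀ : ℝ} (_ : c₀ ≤ 10) (α₀ : ℝ) (_ : 0 < α₀) {α₀' : ℝ} (_ : 0 < α₀') (_ : C0 (d + 1) * α₀' ≤ 1 / 3) (_ : 2 * α₀' ≤ c2' (d + 1) (ℓ + 1))
        (_ : ((d : ℝ) + 1) ^ 2 * α₀' ≤ 1 / 100) (_ : Kpl x.toKIdx ((geo9Y x).M * α₀) * (geo9Y x).L ^ 4 < α₀')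
        (α₁ : ℝ) (_ : 0 < α₁) (_ : (geo9Y x).M * α₁ ≤ a46K d ℓ hd hL b₀ b₁ Mstar N c hc)
        (U : (bg9Y (Matrix (Fin N) (Fin N) ℂ) G x).Cfg) (_ : (bg9KP (Matrix (Fin N) (Fin N) ℂ) G x.toKIdx).Reg335 c₀ α₀ U)
        (_ : (bg9Y (Matrix (Fin N) (Fin N) ℂ) G x).Reg335 c α₁ U)
        {bI : FBondY x.toKIdx → IBondY x.toKIdx} (_ : ∀ f, lvl x.hN x.D x.hk (bI f) = (blkV1 x.hN x.D f).1.1)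
        (_ : ∀ f, (geomT x.D).dist (β x.hN x.D x.hk (bI f)) (blkV1 x.hN x.D f) ≤ 1) (R₀ : ℝ) (H₀ : Prop) [Fintype (geo9Y x).Site],
        BlockBd (g := toB6 (geo9Y x) R₀ H₀) (blkBK (κ := TrIdx N) x.toKIdx bI) (blkBK (κ := TrIdx N) x.toKIdx bI)
          (DvcoKH x.toKIdx (trBasis N) (bg9Y (Matrix (Fin N) (Fin N) ℂ) G x) (fun U => U) U ∘ₗ
            (GcoS x.toKIdx (trBasis N) (bg9Y (Matrix (Fin N) (Fin N) ℂ) G x) (fun U => U) (GpY x.toKIdx (parKnitY x.toKIdx)) U ∘ₗ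
              DvscoKH x.toKIdx (trBasis N) (bg9Y (Matrix (Fin N) (Fin N) ℂ) G x) (fun U => U) U))
          (fun a a' => B46K d ℓ hd hL b₀ b₁ Mstar N c hc * Real.exp (-(δ46K d ℓ hd hL b₀ b₁ Mstar N c hc * (geo9Y x).dist a a'))) :=
  (blockBd_DvGcoSDvs_memberY_knit d ℓ hd hL b₀ b₁ Mstar N hc).choose_spec.choose_spec.choose_spec.choose_spec

/-- `0 < M46K`. [cite: Balaban1985BackgroundPropagators, Thm 3.1 (3.46) p.398, bookkeeping] -/
theorem M46K_pos : 0 < M46K d ℓ hd hL b₀ b₁ Mstar N c hc := (spec46K d ℓ hd hL b₀ b₁ Mstar N c hc).1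

/-- `0 < a46K`. [cite: Balaban1985BackgroundPropagators, Thm 3.1 (3.46) p.398, bookkeeping] -/
theorem a46K_pos : 0 < a46K d ℓ hd hL b₀ b₁ Mstar N c hc := (spec46K d ℓ hd hL b₀ b₁ Mstar N c hc).2.1

/-- `0 < B46K`. [cite: Balaban1985BackgroundPropagators, Thm 3.1 (3.46) p.398, bookkeeping] -/
theorem B46K_pos : 0 < B46K d ℓ hd hL b₀ b₁ Mstar N c hc := (spec46K d ℓ hd hL b₀ b₁ Mstar N c hc).2.2.1

/-- `0 < δ46K`. [cite: Balaban1985BackgroundPropagators, Thm 3.1 (3.46) p.398, bookkeeping] -/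
theorem δ46K_pos : 0 < δ46K d ℓ hd hL b₀ b₁ Mstar N c hc := (spec46K d ℓ hd hL b₀ b₁ Mstar N c hc).2.2.2.1

/-- ★★★ **THE KNIT (3.46)₄ FOR `G′(U; parKnitY)` IN BLOCK-`L²` AT THE NAMED CONSTANTS** — dag-n06-l's `blockBd_DvGcoSDvs_memberY_knit` with its existential constants
replaced by the closed terms `M46K a46K B46K δ46K`: for `G ≤ U(N)` of contractions, every member `x` with `M46K ≤ M_x`, B8's knit numerics (`c₀ ≤ 10`, `α₀ > 0`, `α₀′ > 0`,
`C₀α₀′ ≤ 1∕3`, `2α₀′ ≤ c₂′`, `(d+1)²α₀′ ≤ 1∕100`, `K_pl(M_xα₀)·L⁴ < α₀′`), every `α₁ > 0` with `M_x·α₁ ≤ a46K`, every configuration `U` in BOTH classes `Reg335′ c₀ α₀`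
(`bg9KP`, B8's) and `Reg335 c α₁` (`bg9Y`, B9's), and every level-∕1-faithful index-bond map `bI`: the coordinate letter `D_U ∘ G′(U; parKnitY) ∘ D*_U` has the block-`L²`
bound `‖1_□ D_U G′ D*_U 1_□′‖ ≤ B46K·e^{−δ46K·d(□,□′)}` over `blkBK bI`.  This is the type of the knit certificate's displayed `h46K` at the named constants.
[cite: Balaban1985BackgroundPropagators, Thm 3.1 (3.46) p.398, (3.19) p.393, (3.35) p.396; Balaban1985Averaging, Prop. 2 (52)–(53) p.26; Balaban1984PropagatorsII, (2.46) p.231, (2.51)–(2.54) pp.232–233] -/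
theorem blockBd_DvGcoSDvs_memberY_knit_at {G : Subgroup (Matrix (Fin N) (Fin N) ℂ)ˣ}
    (hG1 : ∀ u : (Matrix (Fin N) (Fin N) ℂ)ˣ, u ∈ G → ‖(u : Matrix (Fin N) (Fin N) ℂ)‖ ≤ 1) (hGU : G ≤ unitaryUnits (Matrix (Fin N) (Fin N) ℂ))
    (x : MemberY d ℓ hd hL b₀ b₁ Mstar) (hM : M46K d ℓ hd hL b₀ b₁ Mstar N c hc ≤ (geo9Y x).M)
    {c₀ : ℝ} (hc₀ : c₀ ≤ 10) (α₀ : ℝ) (hα₀ : 0 < α₀) {α₀' : ℝ} (hα' : 0 < α₀') (hα3 : C0 (d + 1) * α₀' ≤ 1 / 3) (hα2 : 2 * α₀' ≤ c2' (d + 1) (ℓ + 1))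
    (hαd : ((d : ℝ) + 1) ^ 2 * α₀' ≤ 1 / 100) (hK : Kpl x.toKIdx ((geo9Y x).M * α₀) * (geo9Y x).L ^ 4 < α₀')
    (α₁ : ℝ) (hα₁ : 0 < α₁) (ha : (geo9Y x).M * α₁ ≤ a46K d ℓ hd hL b₀ b₁ Mstar N c hc)
    (U : (bg9Y (Matrix (Fin N) (Fin N) ℂ) G x).Cfg) (hregP : (bg9KP (Matrix (Fin N) (Fin N) ℂ) G x.toKIdx).Reg335 c₀ α₀ U)
    (hregY : (bg9Y (Matrix (Fin N) (Fin N) ℂ) G x).Reg335 c α₁ U)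
    {bI : FBondY x.toKIdx → IBondY x.toKIdx} (hlev : ∀ f, lvl x.hN x.D x.hk (bI f) = (blkV1 x.hN x.D f).1.1)
    (hβ1 : ∀ f, (geomT x.D).dist (β x.hN x.D x.hk (bI f)) (blkV1 x.hN x.D f) ≤ 1) (R₀ : ℝ) (H₀ : Prop) [Fintype (geo9Y x).Site] :
    BlockBd (g := toB6 (geo9Y x) R₀ H₀) (blkBK (κ := TrIdx N) x.toKIdx bI) (blkBK (κ := TrIdx N) x.toKIdx bI)
      (DvcoKH x.toKIdx (trBasis N) (bg9Y (Matrix (Fin N) (Fin N) ℂ) G x) (fun U => U) U ∘ₗ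
        (GcoS x.toKIdx (trBasis N) (bg9Y (Matrix (Fin N) (Fin N) ℂ) G x) (fun U => U) (GpY x.toKIdx (parKnitY x.toKIdx)) U ∘ₗ
          DvscoKH x.toKIdx (trBasis N) (bg9Y (Matrix (Fin N) (Fin N) ℂ) G x) (fun U => U) U))
      (fun a a' => B46K d ℓ hd hL b₀ b₁ Mstar N c hc * Real.exp (-(δ46K d ℓ hd hL b₀ b₁ Mstar N c hc * (geo9Y x).dist a a'))) :=
  (spec46K d ℓ hd hL b₀ b₁ Mstar N c hc).2.2.2.2 hG1 hGU x hM hc₀ α₀ hα₀ hα' hα3 hα2 hαd hK α₁ hα₁ ha U hregP hregY hlev hβ1 R₀ H₀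

end Literature.MathematicalPhysics.QuantumFieldTheory.Balaban1983to89.B9Eq346GradGpDivAtPinsL2KnitClosed

end
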